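import Summits.KontsevichZagierPeriods.KontsevichZagierPeriods.Theses.TorsionLogs

/-!
# F3 WITNESS for the rung `NeronTorsionArgument` (line `NeronTorsionArgument` on crux `TorsionSectorComplete`,
# stmt-KontsevichZagierPeriods-14212; forward generator G1 `next-rung`, gen 15, seed g1-KontsevichZagierPeriods-17981)

The rung is the projection-graded family `NeronArgumentMember : Bool → Prop` — member `false` := the floor decl
`Theses.TorsionLogs.NeronTorsionPrimitiveChain` VERBATIM (a REAL torsion point: the Néron value is real — the seed, CLOSED),
member `true` := the tied Néron ARGUMENT sector statement `NeronArgumentSector` (a NON-REAL torsion point of the real curve,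
the IMAGINARY PART of the complex Néron triangle, with the π-, arctangent- and `W₀η₁`-carriers) — and
`NeronTorsionArgument := ∀ b, NeronArgumentMember b`.  The floor specialises the rung at the parameter `b := false`: the seed
theorem (route link `Theses.TorsionLogs.NeronTorsionPrimitiveChain_holds := Cruxes.NeronTorsionSector.Translation.stub_assembly`,
item stmt-KontsevichZagierPeriods-17981) IS that member (`Iff.rfl`).  No `sorry`.  Self-contained: verbatim copies of the three
`def`s of `Lines/NeronTorsionArgument.lean` in the namespace `…NeronTorsionArgument.Special` (the skeleton module proves the same
fact about the registered decl as `rung_false`).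
[cite: KontsevichZagier2001, §1.2] [cite: Lang1983, Ch. 18 §1]
-/

noncomputable section

-- `Summit.KontsevichZagierPeriods.KontsevichZagierPeriods.…` is the tree's mandated layout (single-conjunct summit).
set_option linter.dupNamespace false

namespace Summit.KontsevichZagierPeriods.KontsevichZagierPeriods.Cruxes.TorsionSectorComplete.NeronTorsionArgument.Special

open Literature.NumberTheory.Transcendental
open Summit.KontsevichZagierPeriods.KontsevichZagierPeriods.Theses.TorsionLogs (NeronTorsionPrimitiveChain
  NeronTorsionPrimitiveChain_holds)

/-- Verbatim copy of `Lines/NeronTorsionArgument.lean :: NeronArgumentSector` (member `true`). **Member `true`: the TIED NÉRON ARGUMENT SECTOR.**  Data (gen 8's complex-torsion data verbatim): a real Weierstrass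
curve `y² = f(x) = 4x³ − g₂x − g₃`, `g₂³ ≠ 27g₃²`, roots `e₂ < e₁`, `0 < e₁`, `f > 0` beyond `e₁`, `f < 0` on `(e₂, e₁)`; a
NON-REAL point `P = (x_P, y_P)`, `Im x_P ≠ 0`; the continuous branch `y_c` of `y` along `x(s) = e₁ + s(x_P − e₁)`,
`y_c(1) = y_P`; the complex lattice datum `N·(ω₁/2 + ∫₀¹ (x_P−e₁) ds/y_c) = a·ω₁ + b·(2iW₀)`, `0 < 2a < N`, `0 < 2b < N`
(principal lift; it makes `P` an `N`-torsion point).  Representations pinned: `rJ = [0<s'<s<1, Im((x_P−e₁)² x(s')/(y_c(s')y_c(s)))]`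
(IMAGINARY part of the complex Néron triangle), `rW = [(e₂,e₁)×(e₁,∞), (1/√(−f(x)))·(g₂x'+2g₃)/(2x'²√f(x'))]` (value `W₀η₁`),
`rD = [ℝ, dt/(1+t²)]` (value `π`), `rA = [0<t<γ, dt/(1+t²)]` (value `arctan γ`).  Tie `N²k₁ + M(N−2a)b = 0`; `k₂, m` free;
VALUE HYPOTHESIS `M·rJ + k₁·rW + k₂·rD = m·rA`.  CLAIM: `M•[rJ] + k₁•[rW] + k₂•[rD] − m•[rA] ∈ KZ.relations`.
[cite: KontsevichZagier2001, §1.2] [cite: Lang1983, Ch. 18 §1] -/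
def NeronArgumentSector : Prop :=
  ∀ (g₂ g₃ e₁ e₂ γ : ℝ) (xP yP : ℂ) (yc : ℝ → ℂ) (N a b : ℕ) (M k₁ k₂ m : ℤ) (f : ℝ → ℝ),
    (∀ x, f x = 4 * x ^ 3 - g₂ * x - g₃) → g₂ ^ 3 - 27 * g₃ ^ 2 ≠ 0 → f e₁ = 0 → f e₂ = 0 → e₂ < e₁ → 0 < e₁ →
    (∀ x, e₁ < x → 0 < f x) → (∀ x, e₂ < x → x < e₁ → f x < 0) → xP.im ≠ 0 →
    yP ^ 2 = 4 * xP ^ 3 - (g₂ : ℂ) * xP - (g₃ : ℂ) → ContinuousOn yc (Set.Icc 0 1) → yc 1 = yP →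
    (∀ s ∈ Set.Icc (0 : ℝ) 1,
      yc s ^ 2 = 4 * ((e₁ : ℂ) + (s : ℂ) * (xP - e₁)) ^ 3 - (g₂ : ℂ) * ((e₁ : ℂ) + (s : ℂ) * (xP - e₁)) - (g₃ : ℂ)) →
    (∀ s ∈ Set.Ioc (0 : ℝ) 1, yc s ≠ 0) → 3 ≤ N → 0 < a → 2 * a < N → 0 < b → 2 * b < N →
    (N : ℂ) * (((∫ x in Set.Ioi e₁, (Real.sqrt (f x))⁻¹ : ℝ) : ℂ) + ∫ s in Set.Ioo (0 : ℝ) 1, (xP - e₁) / yc s) =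
      (a : ℂ) * (((2 * ∫ x in Set.Ioi e₁, (Real.sqrt (f x))⁻¹ : ℝ) : ℂ)) +
        (b : ℂ) * (((2 * ∫ x in Set.Ioo e₂ e₁, (Real.sqrt (-f x))⁻¹ : ℝ) : ℂ)) * Complex.I →
    (N : ℤ) ^ 2 * k₁ + M * ((N : ℤ) - 2 * (a : ℤ)) * (b : ℤ) = 0 → 0 < γ →
    ∀ (rJ rW : KZ.IntegralRep 2) (rD rA : KZ.IntegralRep 1),
    rJ.domain = {z | 0 < z 1 ∧ z 1 < z 0 ∧ z 0 < 1} →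
    Set.EqOn rJ.integrand
      (fun z => ((xP - e₁) ^ 2 * ((e₁ : ℂ) + ((z 1 : ℝ) : ℂ) * (xP - e₁)) / (yc (z 1) * yc (z 0))).im) rJ.domain →
    rW.domain = {z | e₂ < z 0 ∧ z 0 < e₁ ∧ e₁ < z 1} →
    Set.EqOn rW.integrand
      (fun z => (Real.sqrt (-f (z 0)))⁻¹ * ((g₂ * z 1 + 2 * g₃) / (2 * (z 1) ^ 2 * Real.sqrt (f (z 1))))) rW.domain →
    rD.domain = Set.univ → Set.EqOn rD.integrand (fun t => (1 + t 0 ^ 2)⁻¹) rD.domain →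
    rA.domain = {t | 0 < t 0 ∧ t 0 < γ} → Set.EqOn rA.integrand (fun t => (1 + t 0 ^ 2)⁻¹) rA.domain →
    (M : ℝ) * rJ.value + k₁ * rW.value + k₂ * rD.value = m * rA.value →
    M • KZ.of rJ + k₁ • KZ.of rW + k₂ • KZ.of rD - m • KZ.of rA ∈ KZ.relations

/-- Verbatim copy of `Lines/NeronTorsionArgument.lean :: NeronArgumentMember`. **The family, graded by the projection read (`false` ↦ real torsion point, real value — the floor; `true` ↦ non-real
torsion point, IMAGINARY part).**  Member `false` is the floor decl `Theses.TorsionLogs.NeronTorsionPrimitiveChain` VERBATIM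
(the seed, CLOSED); member `true` is `NeronArgumentSector`. -/
def NeronArgumentMember : Bool → Prop
  | false => NeronTorsionPrimitiveChain
  | true => NeronArgumentSector

/-- Verbatim copy of `Lines/NeronTorsionArgument.lean :: NeronTorsionArgument` (THE RUNG). **THE RUNG `NeronTorsionArgument`: both members.** `∀ b, NeronArgumentMember b` — the proved floor and the new argument
sector statement. -/
def NeronTorsionArgument : Prop := ∀ imaginary : Bool, NeronArgumentMember imaginary

/-- Member `false` is the floor decl on the nose. -/
theorem false_iff : NeronArgumentMember false ↔ NeronTorsionPrimitiveChain :=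
  Iff.rfl

/-- **F3 witness (named):** the floor (seed `stub_assembly`, route link `NeronTorsionPrimitiveChain_holds`) is the
member `false` of the family (real torsion point, real Néron value). -/
theorem rung_false : NeronArgumentMember false :=
  NeronTorsionPrimitiveChain_holds

/-- The rung is exactly `floor ∧ member true` (honest containment: the rung adds ONE statement to the floor). -/
theorem rung_iff : NeronTorsionArgument ↔ NeronTorsionPrimitiveChain ∧ NeronArgumentSector := by
  constructor
  · exact fun h => ⟨h false, h true⟩
  · rintro ⟨h₀, h₁⟩ (_ | _)
    · exact h₀
    · exact h₁

/-- Given the floor (a theorem), the rung is equivalent to its new member. -/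
theorem rung_iff_true : NeronTorsionArgument ↔ NeronArgumentMember true :=
  ⟨fun h => h true, fun h => rung_iff.mpr ⟨NeronTorsionPrimitiveChain_holds, h⟩⟩

end Summit.KontsevichZagierPeriods.KontsevichZagierPeriods.Cruxes.TorsionSectorComplete.NeronTorsionArgument.Special

end
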